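import Summits.BirchSwinnertonDyer.Rank1Residual.ManinAdditive.TwoEisensteinLegendreRankLaws
import HarnessLib

/-!
# Placement edges for the leaf `TwoEisensteinLegendreRankLaws` (imc g16 «SUPERSINGULAR LEGENDRE MODULE», rows
# E-imc-94/94♭/95/96 + Mazur): refuter-1's kernel read-back lemmas REF1 §R65 RA73.1–RA73.13 and the BY-NAME bridges
# between the rank vocabulary `TwoEisensteinRankLE/GE/Eq` and the tree rows E-imc-81/85/86/96 — cell `bsd-f2-manin`,
# typing ask T-imc-10 (seam), typer g13

Everything here is PROVED and nothing new is asserted: every `theorem` is logic over the two leaves' own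
`def … : Prop`s (`TwoEisensteinRankOneLaws`, `TwoEisensteinLegendreRankLaws`).  Sources: HOME/ref1/ref1-C73-imc-g16-audit.lean
360c58723054a380 `namespace …RefAudit73` (refuter-1 g9, R-imc-35: farm rc 0 · 0/0/0, axioms standard), copied VERBATIM up
to the namespace, the `twoEisensteinRank…` prefixes and the deprecated `push_cast` spelling; RA73.10 (`2·S₂(ℤ) ⊆ Nil`) is
the already-landed `isTwoEisensteinNilpotent_of_isTwiceIntegral` (REF1 RB66.1, `TwoEisensteinRankOneLawsEdges`) and is not
repeated.  The bridges (B) and chains (C) are the typer's short compositions (REF1 §R65 A2: «RankEq (4p) 1 ⟹ tree E-85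
needs one more 3-line bridge (take g₀ from RankGE 1; RankLE 1's spanning vector ≡ g₀ mod 2) — -ty's seam, no obstruction»).

WHAT THE EDGES SAY.  (A) The instance binders `[NeZero (c*p)]` are dischargeable (RA73.1); the modulus
`2^(v₂(p−1)−1)` of E-imc-95 is `≥ 2` under `p ≡ 1 (4)` and `= 2` under `p ≡ 5 (8)` (RA73.5/6), so the degenerate corners
`IsMultipleIntegral N 1` (= integrality) and `IsMultipleIntegral N 0` (= `g = 0`) are never reached (RA73.2–4);
`TwoEisensteinRankEq N 0` is NOT junk-true: it is literally «every 2-Eisenstein-nilpotent form is twice integral»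
(RA73.7–9), and `TwoEisensteinRankGE N 1` is «some nilpotent form is not twice integral» (RA73.11).
(B) BY-NAME BRIDGES (level-wise `Iff`s, then the row-level `Iff`s): `TwoPNoTwoEisenstein` (E-81) `↔ ∀ p, RankEq (2p) 0`;
`FourPNoTwoEisensteinThreeModEight` (E-86) `↔ ∀ p, RankEq (4p) 0`; `MazurNoTwoEisensteinPrimeLevel ↔` the «no nilpotent
form mod 2» shape at level `p`; **`TwoEisensteinRankEq N 1 ↔` the LINE shape** (`∃ g₀` nilpotent, not twice integral, every
nilpotent `g ≡ 0` or `≡ g₀ (mod 2)`), whence `FourPTwoEisensteinRankOne` (E-85) `↔ ∀ p ≡ 5 (8), RankEq (4p) 1`;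
`TwoPTwoEisensteinExistsSevenModEight` (E-96) `↔ ∀ p ≡ 7 (8), RankGE (2p) 1`.
(C) CHAINS: E-94♭ ∧ E-81 ⟹ E-85 (`fourPTwoEisensteinRankOne_of_edge`); E-94 ∧ Mazur ∧ hex ∧ E-81 ⟹ E-85
(`fourPTwoEisensteinRankOne_of_rankLaw`) and ⟹ E-86 away from `p = 3` (`fourPNoTwoEisenstein_of_rankLaw_three_mod_eight`,
RA73.12: the extra `5 ≤ p` is forced by `FourPTwoPRankLaw`'s own binder), where `hex : ∀ N, ∃ r, TwoEisensteinRankEq N r`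
is the existence-of-rank hypothesis recorded by imc in `fourPRankFromTwoP_of_rankLaw` (true since `S₂(ℤ)` is a lattice;
not discharged in this file).  NO «Manin ⟹ law» edge exists for this leaf (the rows are `c`-free, `E`-free statements
about `S₂(Γ₀(N); 𝔽₂)`).  bears_on: stmt-BirchSwinnertonDyer-22967 (C2 `ManinOddAtFour`, stub 6d).
PARTITION 0 · beyond-print theorem: no · BSD is not proved by this; Manin's conjecture is not proved by this.
-/

set_option autoImplicit false

noncomputable section

open scoped MatrixGroups
open CongruenceSubgroup
open Literature.NumberTheory.EllipticCurves Literature.NumberTheory.EllipticCurves.ModularForms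

namespace Summit.BirchSwinnertonDyer.Rank1Residual.ManinAdditive.TwoEisenstein

/-! ### A. refuter-1's kernel read-back lemmas RA73.1–RA73.9, RA73.11 (REF1 §R65, VERBATIM up to names) -/

/-- RA73.1 (trap iii): the `[NeZero (4 * p)]` / `[NeZero (2 * p)]` / `[NeZero p]` binders standing next to `p.Prime` are
dischargeable instances, not extra hypotheses. -/
theorem neZero_mul_of_prime {p : ℕ} (hp : p.Prime) (c : ℕ) (hc : c ≠ 0) : NeZero (c * p) :=
  ⟨Nat.mul_ne_zero hc hp.ne_zero⟩

/-- RA73.2 (trap ii, corner `k = 1`): `IsMultipleIntegral N 1 g` is plain integrality — the degenerate modulus. -/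
theorem isMultipleIntegral_one_iff (N : ℕ) (g : CuspForm (Gamma0 N) 2) :
    IsMultipleIntegral N 1 g ↔ g ∈ integralCuspForms0 N 2 := by
  constructor
  · rintro ⟨h, hh, rfl⟩; simpa using hh
  · intro hg; exact ⟨g, hg, by simp⟩

/-- RA73.3 (trap ii, corner `k = 0`): `IsMultipleIntegral N 0 g` says `g = 0` (exact eigenvector) — the other degenerate
modulus. -/
theorem isMultipleIntegral_zero_iff (N : ℕ) (g : CuspForm (Gamma0 N) 2) :
    IsMultipleIntegral N 0 g ↔ g = 0 := by
  constructor
  · rintro ⟨h, -, rfl⟩; simp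
  · rintro rfl; exact ⟨0, zero_mem _, by simp⟩

/-- RA73.4 `IsMultipleIntegral N 2 = IsTwiceIntegral N`. -/
theorem isMultipleIntegral_two_iff (N : ℕ) (g : CuspForm (Gamma0 N) 2) :
    IsMultipleIntegral N 2 g ↔ IsTwiceIntegral N g := by
  simp only [IsMultipleIntegral, IsTwiceIntegral, Nat.cast_ofNat]

/-- RA73.5 (trap ii discharged): under the hypothesis `p % 4 = 1` of `FourPTwoEisensteinCongruence` the modulus
`2 ^ (padicValNat 2 (p-1) - 1)` is at least `2` — the corners `k = 0, 1` of RA73.2/RA73.3 are never reached. -/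
theorem two_le_two_pow_padicValNat_sub_one {p : ℕ} (hp : p.Prime) (h4 : p % 4 = 1) :
    2 ≤ 2 ^ (padicValNat 2 (p - 1) - 1) := by
  have hp2 := hp.two_le
  have hne : p - 1 ≠ 0 := by omega
  have hdvd : 2 ^ 2 ∣ p - 1 := by
    have : 4 ∣ p - 1 := by omega
    simpa using this
  have hv : 2 ≤ padicValNat 2 (p - 1) := (padicValNat_dvd_iff_le hne).mp hdvd
  calc 2 = 2 ^ 1 := by norm_num
    _ ≤ 2 ^ (padicValNat 2 (p - 1) - 1) := Nat.pow_le_pow_right (by norm_num) (by omega)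

/-- RA73.6: for `p ≡ 5 (mod 8)` the modulus is EXACTLY `2` (depth `v₂((p−1)/2) = 1`), i.e. E-imc-95 there is a plain
mod-2 Eisenstein congruence. -/
theorem two_pow_padicValNat_sub_one_eq_two_of_five_mod_eight {p : ℕ} (h5 : p % 8 = 5) :
    2 ^ (padicValNat 2 (p - 1) - 1) = 2 := by
  have hne : p - 1 ≠ 0 := by omega
  have hdvd : 2 ^ 2 ∣ p - 1 := by
    have : 4 ∣ p - 1 := by omega
    simpa using this
  have hndvd : ¬ 2 ^ 3 ∣ p - 1 := by omega
  have hv : 2 ≤ padicValNat 2 (p - 1) := (padicValNat_dvd_iff_le hne).mp hdvd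
  have hv' : ¬ 3 ≤ padicValNat 2 (p - 1) := fun h => hndvd ((padicValNat_dvd_iff_le hne).mpr h)
  have : padicValNat 2 (p - 1) = 2 := by omega
  rw [this]; norm_num

/-- RA73.7 (trap i, the `r = 0` end): `TwoEisensteinRankGE N 0` holds trivially (empty family) … -/
theorem twoEisensteinRankGE_zero (N : ℕ) [NeZero N] : TwoEisensteinRankGE N 0 :=
  ⟨fun i => i.elim0, fun i => i.elim0, fun _ _ i => i.elim0⟩

/-- RA73.8 … while `TwoEisensteinRankLE N 0` is exactly «every 2-Eisenstein-nilpotent form is twice integral» — the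
shape of the tree rows `TwoPNoTwoEisenstein` (E-81) / `FourPNoTwoEisensteinThreeModEight` (E-86).  So
`TwoEisensteinRankEq N 0` is NOT junk-true. -/
theorem twoEisensteinRankLE_zero_iff (N : ℕ) [NeZero N] :
    TwoEisensteinRankLE N 0 ↔ ∀ g : CuspForm (Gamma0 N) 2, IsTwoEisensteinNilpotent N g → IsTwiceIntegral N g := by
  constructor
  · rintro ⟨gs, -, h⟩ g hg
    obtain ⟨c, hc⟩ := h g hg
    simpa using hc
  · intro h
    exact ⟨fun i => i.elim0, fun i => i.elim0, fun g hg => ⟨fun i => i.elim0, by simpa using h g hg⟩⟩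

/-- RA73.9 `TwoEisensteinRankEq N 0 ↔` «no 2-Eisenstein form at level `N`» (E-81/E-86 shape). -/
theorem twoEisensteinRankEq_zero_iff (N : ℕ) [NeZero N] :
    TwoEisensteinRankEq N 0 ↔ ∀ g : CuspForm (Gamma0 N) 2, IsTwoEisensteinNilpotent N g → IsTwiceIntegral N g := by
  rw [TwoEisensteinRankEq, and_iff_left (twoEisensteinRankGE_zero N), twoEisensteinRankLE_zero_iff]

/-- RA73.11 `TwoEisensteinRankGE N 1 ↔` «some 2-Eisenstein-nilpotent form is not twice integral» — the shape of E-imc-96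
`TwoPTwoEisensteinExistsSevenModEight` and of the existence clause of E-imc-85. -/
theorem twoEisensteinRankGE_one_iff (N : ℕ) [NeZero N] :
    TwoEisensteinRankGE N 1 ↔ ∃ g : CuspForm (Gamma0 N) 2, IsTwoEisensteinNilpotent N g ∧ ¬ IsTwiceIntegral N g := by
  constructor
  · rintro ⟨gs, hgs, hind⟩
    refine ⟨gs 0, hgs 0, fun h2 => ?_⟩
    have := hind (fun _ => 1) (by simpa using h2) 0
    omega
  · rintro ⟨g, hg, hng⟩
    refine ⟨fun _ => g, fun _ => hg, fun c hc i => ?_⟩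
    have hsum : (∑ j : Fin 1, ((c j : ℤ) : ℂ) • (fun _ : Fin 1 => g) j) = ((c 0 : ℤ) : ℂ) • g := by simp
    rw [hsum] at hc
    by_contra hodd
    have hi : i = 0 := Subsingleton.elim _ _
    subst hi
    -- `c 0` odd: write `c 0 = 2m + 1`, then `g = (c 0) • g - 2 • (m • g)` would be twice integral.
    obtain ⟨m, hm⟩ : ∃ m : ℤ, c 0 = 2 * m + 1 := ⟨c 0 / 2, by omega⟩
    obtain ⟨h, hh, hgh⟩ := hc
    apply hng
    refine ⟨h - m • g, sub_mem hh (Submodule.smul_mem _ _ hg.1), ?_⟩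
    have : ((c 0 : ℤ) : ℂ) = 2 * (m : ℂ) + 1 := by rw [hm]; push_cast; ring
    rw [this] at hgh
    rw [smul_sub, ← hgh, add_smul, one_smul, mul_smul, Int.cast_smul_eq_zsmul ℂ] at *
    simp [two_smul]

/-! ### B. The by-name bridges between the rank vocabulary and the tree rows (typer; REF1 §R65 A2 «-ty's seam») -/

/-! #### B.0 closure lemmas for `IsTwiceIntegral` (`2·S₂(ℤ)` is a subgroup of `S₂(ℤ)`) -/

/-- `2·S₂(ℤ)` is closed under addition. [folklore] -/
theorem isTwiceIntegral_add (N : ℕ) {g g' : CuspForm (Gamma0 N) 2}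
    (hg : IsTwiceIntegral N g) (hg' : IsTwiceIntegral N g') : IsTwiceIntegral N (g + g') := by
  obtain ⟨h, hh, rfl⟩ := hg
  obtain ⟨h', hh', rfl⟩ := hg'
  exact ⟨h + h', add_mem hh hh', by rw [smul_add]⟩

/-- `2·S₂(ℤ)` is closed under negation. [folklore] -/
theorem isTwiceIntegral_neg (N : ℕ) {g : CuspForm (Gamma0 N) 2} (hg : IsTwiceIntegral N g) :
    IsTwiceIntegral N (-g) := by
  obtain ⟨h, hh, rfl⟩ := hg
  exact ⟨-h, neg_mem hh, by rw [smul_neg]⟩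

/-- `2·S₂(ℤ)` is closed under subtraction. [folklore] -/
theorem isTwiceIntegral_sub (N : ℕ) {g g' : CuspForm (Gamma0 N) 2}
    (hg : IsTwiceIntegral N g) (hg' : IsTwiceIntegral N g') : IsTwiceIntegral N (g - g') := by
  rw [sub_eq_add_neg]; exact isTwiceIntegral_add N hg (isTwiceIntegral_neg N hg')

/-- `2·S₂(ℤ)` is closed under integer multiples. [folklore] -/
theorem isTwiceIntegral_intCast_smul (N : ℕ) {g : CuspForm (Gamma0 N) 2} (c : ℤ) (hg : IsTwiceIntegral N g) :
    IsTwiceIntegral N ((c : ℂ) • g) := by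
  obtain ⟨h, hh, rfl⟩ := hg
  refine ⟨(c : ℂ) • h, ?_, by rw [smul_comm]⟩
  rw [Int.cast_smul_eq_zsmul ℂ]; exact Submodule.smul_mem _ c hh

/-- an EVEN integer multiple of an integral form is twice integral. [folklore] -/
theorem isTwiceIntegral_intCast_smul_of_two_dvd (N : ℕ) {h : CuspForm (Gamma0 N) 2}
    (hh : h ∈ integralCuspForms0 N 2) {c : ℤ} (hc : (2 : ℤ) ∣ c) : IsTwiceIntegral N ((c : ℂ) • h) := by
  obtain ⟨m, rfl⟩ := hc
  refine ⟨(m : ℂ) • h, ?_, ?_⟩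
  · rw [Int.cast_smul_eq_zsmul ℂ]; exact Submodule.smul_mem _ m hh
  · rw [Int.cast_mul, Int.cast_ofNat, mul_smul]

/-- the spanning clause of `TwoEisensteinRankLE N 1` read at one vector: `g ≡ c • h (mod 2)`; if `c` is even then `g`
itself is twice integral. [folklore] -/
theorem isTwiceIntegral_of_sub_smul_of_two_dvd (N : ℕ) {g h : CuspForm (Gamma0 N) 2}
    (hh : h ∈ integralCuspForms0 N 2) {c : ℤ} (hc : (2 : ℤ) ∣ c) (hgc : IsTwiceIntegral N (g - (c : ℂ) • h)) :
    IsTwiceIntegral N g := by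
  have := isTwiceIntegral_add N hgc (isTwiceIntegral_intCast_smul_of_two_dvd N hh hc)
  simpa using this

/-! #### B.1 level-wise bridges -/

/-- **The LINE bridge (REF1 §R65 A2, «3-line bridge»).**  `TwoEisensteinRankEq N 1` is EXACTLY the line shape of
E-imc-85 at level `N`: some 2-Eisenstein-nilpotent integral form `g₀` is not twice integral, and every nilpotent form is
`≡ 0` or `≡ g₀ (mod 2·S₂(ℤ))`.  (→: take `g₀` from `RankGE 1`; the spanning vector `h` of `RankLE 1` has `g₀ ≡ c₀ h` with
`c₀` odd, and every nilpotent `g ≡ c h`, so `g ≡ 0` (`c` even) or `g − g₀ ≡ (c − c₀) h ≡ 0` (`c` odd).  ←: `gs := g₀`.)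
[folklore] -/
theorem twoEisensteinRankEq_one_iff (N : ℕ) [NeZero N] :
    TwoEisensteinRankEq N 1 ↔ ∃ g₀ : CuspForm (Gamma0 N) 2,
      IsTwoEisensteinNilpotent N g₀ ∧ ¬ IsTwiceIntegral N g₀ ∧
        ∀ g : CuspForm (Gamma0 N) 2, IsTwoEisensteinNilpotent N g →
          IsTwiceIntegral N g ∨ IsTwiceIntegral N (g - g₀) := by
  constructor
  · rintro ⟨⟨gs, hgsL, hspan⟩, hGE⟩
    obtain ⟨g₀, hg₀, hng₀⟩ := (twoEisensteinRankGE_one_iff N).mp hGE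
    refine ⟨g₀, hg₀, hng₀, fun g hg => ?_⟩
    have hL : gs 0 ∈ integralCuspForms0 N 2 := hgsL 0
    obtain ⟨c₀, hc₀⟩ := hspan g₀ hg₀
    obtain ⟨c, hc⟩ := hspan g hg
    simp only [Finset.univ_unique, Fin.default_eq_zero, Finset.sum_singleton] at hc₀ hc
    have hodd₀ : ¬ (2 : ℤ) ∣ c₀ 0 := fun h2 => hng₀ (isTwiceIntegral_of_sub_smul_of_two_dvd N hL h2 hc₀)
    by_cases h2 : (2 : ℤ) ∣ c 0
    · exact Or.inl (isTwiceIntegral_of_sub_smul_of_two_dvd N hL h2 hc)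
    · refine Or.inr ?_
      have hev : (2 : ℤ) ∣ c 0 - c₀ 0 := by omega
      have key := isTwiceIntegral_add N (isTwiceIntegral_sub N hc hc₀)
        (isTwiceIntegral_intCast_smul_of_two_dvd N hL hev)
      have hid : g - (c 0 : ℂ) • gs 0 - (g₀ - (c₀ 0 : ℂ) • gs 0) + ((c 0 - c₀ 0 : ℤ) : ℂ) • gs 0 = g - g₀ := by
        rw [Int.cast_sub, sub_smul]; abel
      rwa [hid] at key
  · rintro ⟨g₀, hg₀, hng₀, hline⟩
    refine ⟨⟨fun _ => g₀, fun _ => hg₀.1, fun g hg => ?_⟩, (twoEisensteinRankGE_one_iff N).mpr ⟨g₀, hg₀, hng₀⟩⟩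
    rcases hline g hg with h0 | h1
    · exact ⟨fun _ => 0, by simpa using h0⟩
    · exact ⟨fun _ => 1, by simpa using h1⟩

/-! #### B.2 row-level bridges (the tree rows BY NAME) -/

/-- E-imc-81 `TwoPNoTwoEisenstein` is «`RankEq (2p) 0` for every prime `p ≡ ±3 (mod 8)`» (RA73.9 on the verbatim bodies).
[folklore] -/
theorem twoPNoTwoEisenstein_iff_rankEq_zero :
    TwoPNoTwoEisenstein ↔
      ∀ (p : ℕ) [NeZero (2 * p)], p.Prime → (p % 8 = 3 ∨ p % 8 = 5) → TwoEisensteinRankEq (2 * p) 0 := by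
  refine forall_congr' fun p => forall_congr' fun _ => forall_congr' fun _ => forall_congr' fun _ => ?_
  rw [twoEisensteinRankEq_zero_iff]

/-- E-imc-86 `FourPNoTwoEisensteinThreeModEight` is «`RankEq (4p) 0` for every prime `p ≡ 3 (mod 8)`». [folklore] -/
theorem fourPNoTwoEisensteinThreeModEight_iff_rankEq_zero :
    FourPNoTwoEisensteinThreeModEight ↔
      ∀ (p : ℕ) [NeZero (4 * p)], p.Prime → p % 8 = 3 → TwoEisensteinRankEq (4 * p) 0 := by
  refine forall_congr' fun p => forall_congr' fun _ => forall_congr' fun _ => forall_congr' fun _ => ?_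
  rw [twoEisensteinRankEq_zero_iff]

/-- `MazurNoTwoEisensteinPrimeLevel` unfolded to the «no nilpotent form mod 2» shape at prime level `p ≥ 5`,
`p ≢ 1 (mod 8)` (RA73.9). [folklore] -/
theorem mazurNoTwoEisensteinPrimeLevel_iff :
    MazurNoTwoEisensteinPrimeLevel ↔
      ∀ (p : ℕ) [NeZero p], p.Prime → 5 ≤ p → p % 8 ≠ 1 →
        ∀ g : CuspForm (Gamma0 p) 2, IsTwoEisensteinNilpotent p g → IsTwiceIntegral p g := by
  refine forall_congr' fun p => forall_congr' fun _ => forall_congr' fun _ => forall_congr' fun _ =>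
    forall_congr' fun _ => ?_
  rw [twoEisensteinRankEq_zero_iff]

/-- **E-imc-85 `FourPTwoEisensteinRankOne` is «`RankEq (4p) 1` for every prime `p ≡ 5 (mod 8)`»** (the line bridge
`twoEisensteinRankEq_one_iff` on the verbatim bodies). [folklore] -/
theorem fourPTwoEisensteinRankOne_iff_rankEq_one :
    FourPTwoEisensteinRankOne ↔
      ∀ (p : ℕ) [NeZero (4 * p)], p.Prime → p % 8 = 5 → TwoEisensteinRankEq (4 * p) 1 := by
  refine forall_congr' fun p => forall_congr' fun _ => forall_congr' fun _ => forall_congr' fun _ => ?_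
  rw [twoEisensteinRankEq_one_iff]

/-- E-imc-96 `TwoPTwoEisensteinExistsSevenModEight` is «`RankGE (2p) 1` for every prime `p ≡ 7 (mod 8)`» (RA73.11).
[folklore] -/
theorem twoPTwoEisensteinExistsSevenModEight_iff_rankGE_one :
    TwoPTwoEisensteinExistsSevenModEight ↔
      ∀ (p : ℕ) [NeZero (2 * p)], p.Prime → p % 8 = 7 → TwoEisensteinRankGE (2 * p) 1 := by
  refine forall_congr' fun p => forall_congr' fun _ => forall_congr' fun _ => forall_congr' fun _ => ?_
  rw [twoEisensteinRankGE_one_iff]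

/-! ### C. Chains (REF1 RA73.12/13 + the bridges): E-94♭ ∧ E-81 ⟹ E-85; E-94 ∧ Mazur ∧ hex ∧ E-81 ⟹ E-85 / E-86 -/

/-- RA73.13 (E-94♭ + `RankEq (2p) 0` ⟹ rank one at `4p`, the stub-6d reading): with `D(2p) = 0` the edge gives
`D(4p) = 1`. -/
theorem twoEisensteinRankEq_fourP_one_of_edge (h94b : FourPRankFromTwoPFiveModEight)
    (p : ℕ) [NeZero (2 * p)] [NeZero (4 * p)] (hp : p.Prime) (h5 : p % 8 = 5)
    (h81 : TwoEisensteinRankEq (2 * p) 0) : TwoEisensteinRankEq (4 * p) 1 := by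
  simpa using h94b p hp h5 0 h81

/-- **E-94♭ ∧ E-81 ⟹ E-85 BY NAME** (`FourPRankFromTwoPFiveModEight → TwoPNoTwoEisenstein → FourPTwoEisensteinRankOne`):
RA73.13 fed by the bridge `twoPNoTwoEisenstein_iff_rankEq_zero` and read back through
`fourPTwoEisensteinRankOne_iff_rankEq_one`. [folklore] -/
theorem fourPTwoEisensteinRankOne_of_edge (h94b : FourPRankFromTwoPFiveModEight) (h81 : TwoPNoTwoEisenstein) :
    FourPTwoEisensteinRankOne := by
  rw [fourPTwoEisensteinRankOne_iff_rankEq_one]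
  intro p _ hp h5
  haveI : NeZero (2 * p) := neZero_mul_of_prime hp 2 two_ne_zero
  exact twoEisensteinRankEq_fourP_one_of_edge h94b p hp h5
    (twoPNoTwoEisenstein_iff_rankEq_zero.mp h81 p hp (Or.inr h5))

/-- **E-94 ∧ Mazur ∧ hex ∧ E-81 ⟹ E-85 BY NAME**: imc's edge `fourPRankFromTwoP_of_rankLaw` followed by
`fourPTwoEisensteinRankOne_of_edge`; `hex` = every level has SOME 2-Eisenstein rank (true since `S₂(Γ₀(N); ℤ)` is a
finitely generated free `ℤ`-module; kept as a hypothesis here exactly as in the leaf). [folklore] -/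
theorem fourPTwoEisensteinRankOne_of_rankLaw (hlaw : FourPTwoPRankLaw) (hMazur : MazurNoTwoEisensteinPrimeLevel)
    (hex : ∀ (N : ℕ) [NeZero N], ∃ r, TwoEisensteinRankEq N r) (h81 : TwoPNoTwoEisenstein) :
    FourPTwoEisensteinRankOne :=
  fourPTwoEisensteinRankOne_of_edge (fourPRankFromTwoP_of_rankLaw hlaw hMazur hex) h81

/-- RA73.12 (E-94 at `p ≡ 3 (mod 8)`, mirror of the leaf's edge): the rank law + Mazur give `D(4p) = 2·D(2p)`; note the
extra `5 ≤ p` (the residue class `p ≡ 3 (8)` contains `p = 3`, which `FourPTwoPRankLaw` excludes). -/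
theorem twoEisensteinRankEq_fourP_double_of_rankLaw_three_mod_eight (hlaw : FourPTwoPRankLaw)
    (hMazur : MazurNoTwoEisensteinPrimeLevel) (hex : ∀ (N : ℕ) [NeZero N], ∃ r, TwoEisensteinRankEq N r)
    (p : ℕ) [NeZero (2 * p)] [NeZero (4 * p)] (hp : p.Prime) (h5 : 5 ≤ p) (h3 : p % 8 = 3)
    (r : ℕ) (hr : TwoEisensteinRankEq (2 * p) r) : TwoEisensteinRankEq (4 * p) (2 * r) := by
  haveI : NeZero p := ⟨hp.ne_zero⟩
  have h81 : p % 8 ≠ 1 := by omega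
  have h41 : ¬ p % 4 = 1 := by omega
  obtain ⟨r₄, hr₄⟩ := hex (4 * p)
  have key := hlaw p hp h5 0 r r₄ (hMazur p hp h5 h81) hr hr₄
  rw [if_neg h41] at key
  have : r₄ = 2 * r := by omega
  rw [← this]; exact hr₄

/-- **E-94 ∧ Mazur ∧ hex ∧ E-81 ⟹ E-86 away from `p = 3`** (`D(2p) = 0 ⟹ D(4p) = 0` for primes `p ≡ 3 (mod 8)`,
`p ≥ 5`; at `p = 3` the row E-86 is the statement `S₂(Γ₀(12); 𝔽₂)^{Eis-nil} = 0`, outside `FourPTwoPRankLaw`'s range).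
[folklore] -/
theorem fourPNoTwoEisenstein_of_rankLaw_three_mod_eight (hlaw : FourPTwoPRankLaw)
    (hMazur : MazurNoTwoEisensteinPrimeLevel) (hex : ∀ (N : ℕ) [NeZero N], ∃ r, TwoEisensteinRankEq N r)
    (h81 : TwoPNoTwoEisenstein) (p : ℕ) [NeZero (4 * p)] (hp : p.Prime) (h5 : 5 ≤ p) (h3 : p % 8 = 3) :
    ∀ g : CuspForm (Gamma0 (4 * p)) 2, IsTwoEisensteinNilpotent (4 * p) g → IsTwiceIntegral (4 * p) g := by
  haveI : NeZero (2 * p) := neZero_mul_of_prime hp 2 two_ne_zero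
  have h0 : TwoEisensteinRankEq (2 * p) 0 := twoPNoTwoEisenstein_iff_rankEq_zero.mp h81 p hp (Or.inl h3)
  have h4 := twoEisensteinRankEq_fourP_double_of_rankLaw_three_mod_eight hlaw hMazur hex p hp h5 h3 0 h0
  rw [mul_zero] at h4
  exact (twoEisensteinRankEq_zero_iff (4 * p)).mp h4

end Summit.BirchSwinnertonDyer.Rank1Residual.ManinAdditive.TwoEisenstein

end
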